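import Summits.ResolutionOfSingularities.ResolutionOfSingularities.Theorems.FrobeniusClosingSteerNoEternalChainCore
import Literature.AlgebraicGeometry.Resolution.LipmanNoEternalNormalBranch
import Literature.AlgebraicGeometry.Resolution.NormalAscent
import Literature.AlgebraicGeometry.Resolution.RegularLocalRingsQuotient
import Literature.AlgebraicGeometry.Resolution.PowerSeriesRegularLocal
import Literature.AlgebraicGeometry.Resolution.ExcellentRings
import Mathlib.Algebra.CharP.Subring
import HarnessLib

/-!
# Crux `Steer` (stmt-ResolutionOfSingularities-16345), chain W4.1, R2 σ_top line: **K(2)** —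
# no eternal isolated radicand chain in codimension two, from Lipman 1978 (Theses-free helper)

OURS (campaign `res-hironaka`, rung L ★L-G4, slot W4.1, chain W4.1, seat `res-type-026` on
res-L0-w41-plan-1's ORDER 2026-08-27T05:10:18Z; replaces the role of no printed item; NOT a statement of the
manuscript under review; AI review is weaker than expert review). Support piece
**K(2) = `∀ p prime, NoEternalIsolatedRadicandChain p 2`** of the planner's typed sub-plan
`L/w41/Sketch-R2-steered.lean` (res-L0-w41-plan-1 g5, sha16 fb4f9514a6cb98fe, §3.1 — idea-1's
`NoEternalIsolatedRadicandChain` VERBATIM, the case `c = 2`), CONDITIONAL on the named fact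
`Literature.AlgebraicGeometry.Resolution.Lipman1978NoEternalNormalBranch` (p497185; Lipman 1978 THEOREM p. 151 /
Artin 1986 Thm. (1.1) / Liu 2002 Thm. 8.3.44, followed along one branch of closed points).

## What is here (the algebra of the torsor germ; the realisation layer is the sibling file
`FrobeniusClosingSteerRadicandChainRealisation.lean`, seat res-L1-type-o8, SPLIT agreed on STATUS 05:25–05:29Z)

For a regular local ring `S` of dimension two and characteristic `p` and a radicand `f ∈ S`, let
`T := S[X]/(X^p − f)` (`AdjoinRoot`; idea-1's `RadicandRing S p f`), a local ring, finite free of rank `p` over `S`.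

* `RadicandChainTwo.exists_regular_pair` — a regular local ring of dimension two has `x, y ∈ 𝔪`, `x ≠ 0`, with
  `y` regular on `S/xS` (`x ∈ 𝔪 ∖ 𝔪²` is prime, Matsumura 14.2/14.3; `S/xS` is regular of dimension one, so its
  maximal ideal is non-zero: lift a non-zero element).
* `RadicandChainTwo.isReduced_of_isolated` — if every NON-maximal prime of `T` has a regular local ring
  (isolated singularity) and `S` is a local Noetherian domain which is not a field, then `T` is reduced (a non-zero
  nilpotent `w` has `Ann(w) ⊆ P` for a prime `P ≠ 𝔑`, since `T` is torsion-free over `S`, and then `T_P` is not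
  reduced — the argument of K(1), `NoEternalChainOne.false_of_frobeniusChain`).
* `RadicandChainTwo.isIntegrallyClosed_of_isolated` — **normality WITHOUT Serre's criterion**: by
  `isIntegrallyClosed_of_forall_colon` (Stacks 031S, sufficiency, `NormalAscent.lean`) it suffices that `T_P` is a
  normal domain for every prime `P` which is the annihilator of an element of `T/sT`, `s` a nonzerodivisor. For
  `P ≠ 𝔑` this is isolatedness (regular ⇒ normal domain, Matsumura 19.4). `P = 𝔑` is impossible: `x ∈ 𝔑` gives
  `x z = s w`, and by the exchange lemma `𝔑 = Ann(w̄ ∈ T/xT)`; but `y ∈ 𝔑` is `T/xT`-regular (flat base change of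
  the `S/xS`-regular element `y`, `forall_mem_span_algebraMap_of_flat`), so `w ∈ xT` and `1 ∈ 𝔑`.
* `RadicandChainTwo.isDomain_of_isolated` — reduced + integrally closed + local Noetherian ⇒ domain
  (`isDomain_of_isReduced_of_isIntegrallyClosed`).
* `RadicandChainTwo.not_isRegularLocalRing_of_sub_pow_mem_sq` — the **singularity criterion** (⇒): if
  `f − h^p ∈ 𝔪²` then `T` is not regular: `X^p − f = (X − h)^p − (f − h^p) ∈ 𝔔²` for the maximal ideal
  `𝔔 = (𝔪, X − h)` of `S[X]` over `𝔑`, so `T_𝔑 = (S[X]/(F))_𝔑` is a singular hypersurface germ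
  (`not_isRegularLocalRing_localization_quotient_of_mem_sq`), while `T` regular would make `T_𝔑` regular
  (Matsumura 19.3).
* `RadicandChainTwo.false_of_realisation` — **K(2) given a realisation**: if the torsor germs `T m` of a chain
  as in `NoEternalIsolatedRadicandChain p 2` are realised as a branch `R : ℕ → Subring K′` of quadratic transforms
  of two-dimensional local rings of a field `K′` with `R 0` a Noetherian excellent local ring of `K′`
  (`T m ≃+* R m`), then Lipman's theorem gives a regular member, contradicting the criterion at the cleaned
  multiplicity `f m − h^p ∈ 𝔪^p ⊆ 𝔪²`.

[cite: Lipman1978, Thm. p. 151] [cite: Artin1986, Thm. (1.1)] [cite: StacksProject, Tag 031S]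
[cite: Matsumura1987, Thm. 14.2, Thm. 19.3, Thm. 19.4] [folklore]
-/

noncomputable section

-- `Summit.<S>.<S>.…` duplicates the summit name by design (single-problem summit).
set_option linter.dupNamespace false

open Polynomial IsLocalRing

namespace Summit.ResolutionOfSingularities.ResolutionOfSingularities.Theorems.SwitchingDichotomy

open Literature.AlgebraicGeometry.Resolution

namespace RadicandChainTwo

universe u

/-! ## (1) A regular pair in a regular local ring of dimension two -/

section RegularPair

variable {S : Type u} [CommRing S]

/-- In a regular local ring of dimension two there are `x, y ∈ 𝔪` with `x ≠ 0` and `y` regular on `S/xS`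
(`x ∈ 𝔪 ∖ 𝔪²` is a prime element and `S/xS`, regular of dimension one, has a non-zero non-unit).
[cite: Matsumura1987, Thm. 14.2] [folklore] -/
theorem exists_regular_pair [IsRegularLocalRing S] (hdim : ringKrullDim S = (2 : ℕ)) :
    ∃ x y : S, x ∈ maximalIdeal S ∧ x ≠ 0 ∧ y ∈ maximalIdeal S ∧
      ∀ c : S, y * c ∈ Ideal.span {x} → c ∈ Ideal.span {x} := by
  have h0 : ringKrullDim S ≠ 0 := by
    intro h0
    rw [hdim] at h0
    have h2 : (2 : ℕ) = 0 := by exact_mod_cast h0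
    exact absurd h2 two_ne_zero
  obtain ⟨x, hx, hx2⟩ := IsRegularLocalRing.exists_not_mem_sq (R := S) h0
  have hxprime : Prime x := IsRegularLocalRing.prime_of_not_mem_sq hx hx2
  obtain ⟨hreg', hdim'⟩ := IsRegularLocalRing.quotient_span_singleton hx hx2
  haveI := hreg'
  have hdim1 : ringKrullDim (S ⧸ Ideal.span {x}) ≠ 0 := by
    intro h0'
    rw [h0', hdim, zero_add] at hdim'
    have h1 : ((1 : ℕ) : WithBot ℕ∞) = ((2 : ℕ) : WithBot ℕ∞) := by
      rw [← hdim']; push_cast; rfl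
    have h2 : (1 : ℕ) = 2 := by exact_mod_cast h1
    exact absurd h2 (by norm_num)
  obtain ⟨ybar, hybar, hybar2⟩ :=
    IsRegularLocalRing.exists_not_mem_sq (R := S ⧸ Ideal.span {x}) hdim1
  have hybar0 : ybar ≠ 0 := by
    rintro rfl; exact hybar2 (Ideal.zero_mem _)
  obtain ⟨y, rfl⟩ := Ideal.Quotient.mk_surjective ybar
  refine ⟨x, y, hx, hxprime.ne_zero, ?_, fun c hc => ?_⟩
  · rw [mem_maximalIdeal, mem_nonunits_iff] at hybar ⊢
    exact fun hu => hybar (hu.map _)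
  · rw [Ideal.mem_span_singleton] at hc ⊢
    rcases hxprime.dvd_or_dvd hc with h | h
    · exact absurd (Ideal.Quotient.eq_zero_iff_mem.mpr (Ideal.mem_span_singleton.mpr h)) hybar0
    · exact h

end RegularPair

/-! ## (2) The torsor germ `T = S[X]/(X^p − f)` with isolated singularity is a normal domain -/

section Radicand

variable {S : Type u} [CommRing S] (p : ℕ) [hp : Fact p.Prime] [CharP S p] (f : S)

/-- **Reducedness from isolatedness.** Over a Noetherian local domain `S` which is not a field, if every
non-maximal prime of `T = S[X]/(X^p − f)` has a regular local ring then `T` is reduced: a non-zero nilpotent `w`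
has `Ann(w) ⊆ P` for some prime `P ≠ 𝔑` (otherwise a power of a non-zero `y ∈ 𝔪_S` kills `w`, but `T` is
torsion-free over `S`), and then `T_P` is a non-reduced regular local ring — absurd. (The argument of K(1).)
[cite: Matsumura1987, Thm. 14.3] [folklore] -/
theorem isReduced_of_isolated [IsDomain S] [IsLocalRing S] [IsNoetherianRing S]
    (hS : maximalIdeal S ≠ ⊥)
    (hisol : ∀ (P : Ideal (AdjoinRoot ((X : S[X]) ^ p - C f))) [P.IsPrime],
      (∃ Q : Ideal (AdjoinRoot ((X : S[X]) ^ p - C f)), Q.IsPrime ∧ P < Q) →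
      IsRegularLocalRing (Localization.AtPrime P)) :
    IsReduced (AdjoinRoot ((X : S[X]) ^ p - C f)) := by
  classical
  set F : S[X] := (X : S[X]) ^ p - C f with hF
  haveI hloc' : IsLocalRing (AdjoinRoot F) := isLocalRing_adjoinRoot_X_pow_sub_C_of_charP p f
  have hmon : F.Monic := NoEternalChainOne.monic_X_pow_sub_C' p f
  haveI : Module.Finite S (AdjoinRoot F) := hmon.finite_adjoinRoot
  haveI : Module.Free S (AdjoinRoot F) := hmon.free_adjoinRoot
  have hmaple := NoEternalChainOne.map_maximalIdeal_le p f
  by_contra hred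
  rw [isReduced_iff, not_forall] at hred
  obtain ⟨w, hw⟩ := hred
  rw [Classical.not_imp] at hw
  obtain ⟨hwnil, hw0⟩ := hw
  set J : Ideal (AdjoinRoot F) := (Submodule.span (AdjoinRoot F) {w}).annihilator with hJ_def
  have hJ : ∀ s, s ∈ J ↔ s * w = 0 := fun s => by
    rw [hJ_def, Submodule.mem_annihilator_span_singleton, smul_eq_mul]
  have hP : ∃ P : Ideal (AdjoinRoot F), P.IsPrime ∧ J ≤ P ∧ P ≠ maximalIdeal (AdjoinRoot F) := by
    by_contra hcon
    have hrad : maximalIdeal (AdjoinRoot F) ≤ J.radical := by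
      rw [Ideal.radical_eq_sInf]
      refine le_sInf ?_
      rintro Q ⟨hJQ, hQ⟩
      by_cases hQe : Q = maximalIdeal (AdjoinRoot F)
      · exact hQe.symm.le
      · exact absurd ⟨Q, hQ, hJQ, hQe⟩ hcon
    obtain ⟨y, hy, hy0⟩ := Submodule.exists_mem_ne_zero_of_ne_bot hS
    obtain ⟨N, hN⟩ := hrad (hmaple (Ideal.mem_map_of_mem _ hy))
    have hyw : (y ^ N) • w = 0 := by
      rw [Algebra.smul_def, map_pow]
      exact (hJ _).mp hN
    exact hw0 ((smul_eq_zero.mp hyw).resolve_left (pow_ne_zero N hy0))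
  obtain ⟨P, hPp, hJP, hPne⟩ := hP
  haveI := hPp
  have hlt : P < maximalIdeal (AdjoinRoot F) :=
    lt_of_le_of_ne (IsLocalRing.le_maximalIdeal hPp.ne_top) hPne
  haveI := hisol P ⟨maximalIdeal (AdjoinRoot F), inferInstance, hlt⟩
  haveI : IsDomain (Localization.AtPrime P) := isDomain_of_isRegularLocalRing _
  have h0 : algebraMap (AdjoinRoot F) (Localization.AtPrime P) w = 0 :=
    (hwnil.map (algebraMap (AdjoinRoot F) (Localization.AtPrime P))).eq_zero
  rw [IsLocalization.map_eq_zero_iff P.primeCompl] at h0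
  obtain ⟨⟨s, hs⟩, hsw⟩ := h0
  exact hs (hJP ((hJ s).mpr hsw))

/-- **Normality from isolatedness, without Serre's criterion.** Over a regular local ring `S` of dimension two,
if every non-maximal prime of `T = S[X]/(X^p − f)` has a regular local ring then `T` is integrally closed (in its
total ring of fractions): by `isIntegrallyClosed_of_forall_colon` (Stacks 031S) one checks the primes `P`
which are annihilators of elements of `T/sT` (`s` a nonzerodivisor); `P ≠ 𝔑` is regular, hence a normal
domain (Matsumura 19.4); `P = 𝔑` cannot occur: exchanging `s` for `x ∈ 𝔪 ∖ 𝔪²` makes `𝔑` the annihilator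
of some `w̄ ∈ T/xT`, but the `S/xS`-regular `y ∈ 𝔪 ⊆ 𝔑` stays `T/xT`-regular by flatness, forcing `w ∈ xT`
and `1 ∈ 𝔑`. [cite: StacksProject, Tag 031S] [cite: Matsumura1987, Thm. 19.4] [folklore] -/
theorem isIntegrallyClosed_of_isolated [IsRegularLocalRing S] (hdim : ringKrullDim S = (2 : ℕ))
    (hisol : ∀ (P : Ideal (AdjoinRoot ((X : S[X]) ^ p - C f))) [P.IsPrime],
      (∃ Q : Ideal (AdjoinRoot ((X : S[X]) ^ p - C f)), Q.IsPrime ∧ P < Q) →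
      IsRegularLocalRing (Localization.AtPrime P)) :
    IsIntegrallyClosed (AdjoinRoot ((X : S[X]) ^ p - C f)) := by
  classical
  set F : S[X] := (X : S[X]) ^ p - C f with hF
  haveI hloc' : IsLocalRing (AdjoinRoot F) := isLocalRing_adjoinRoot_X_pow_sub_C_of_charP p f
  have hmon : F.Monic := NoEternalChainOne.monic_X_pow_sub_C' p f
  haveI : Module.Finite S (AdjoinRoot F) := hmon.finite_adjoinRoot
  haveI : Module.Free S (AdjoinRoot F) := hmon.free_adjoinRoot
  haveI : IsNoetherianRing (AdjoinRoot F) :=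
    inferInstanceAs (IsNoetherianRing (S[X] ⧸ Ideal.span {F}))
  haveI := isDomain_of_isRegularLocalRing S
  have hmaple := NoEternalChainOne.map_maximalIdeal_le p f
  obtain ⟨x, y, hx, hx0, hy, hyreg⟩ := exists_regular_pair (S := S) hdim
  have hxreg : IsSMulRegular S x := (IsRegular.of_ne_zero hx0).left.isSMulRegular
  -- `x` is a nonzerodivisor of `T` (free over the domain `S`)
  have hx'nzd : algebraMap S (AdjoinRoot F) x ∈ nonZeroDivisors (AdjoinRoot F) := by
    rw [mem_nonZeroDivisors_iff_right]
    intro t ht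
    rw [mul_comm, ← Algebra.smul_def] at ht
    exact (smul_eq_zero.mp ht).resolve_left hx0
  refine isIntegrallyClosed_of_forall_colon fun s z hs P _ hP => ?_
  by_cases hPN : P = maximalIdeal (AdjoinRoot F)
  · exfalso
    have hx'P : algebraMap S (AdjoinRoot F) x ∈ P := hPN ▸ hmaple (Ideal.mem_map_of_mem _ hx)
    have hy'P : algebraMap S (AdjoinRoot F) y ∈ P := hPN ▸ hmaple (Ideal.mem_map_of_mem _ hy)
    obtain ⟨w, hw⟩ := Ideal.mem_span_singleton'.mp ((hP _).mp hx'P)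
    have hexch : ∀ c, c * w ∈ Ideal.span {algebraMap S (AdjoinRoot F) x} ↔ c * z ∈ Ideal.span {s} :=
      fun c => mul_mem_span_singleton_iff_of_mul_eq_mul hx'nzd hs (by rw [mul_comm]; exact hw) c
    have hyw : algebraMap S (AdjoinRoot F) y * w ∈ Ideal.span {algebraMap S (AdjoinRoot F) x} :=
      (hexch _).mpr ((hP _).mp hy'P)
    have hwx : w ∈ Ideal.span {algebraMap S (AdjoinRoot F) x} :=
      forall_mem_span_algebraMap_of_flat hxreg hyreg w hyw
    have h1 : (1 : AdjoinRoot F) ∈ P := by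
      rw [hP 1, ← hexch 1, one_mul]; exact hwx
    exact (Ideal.IsPrime.ne_top ‹_›) ((Ideal.eq_top_iff_one _).mpr h1)
  · have hlt : P < maximalIdeal (AdjoinRoot F) :=
      lt_of_le_of_ne (IsLocalRing.le_maximalIdeal (Ideal.IsPrime.ne_top ‹_›)) hPN
    haveI := hisol P ⟨maximalIdeal (AdjoinRoot F), inferInstance, hlt⟩
    exact ⟨isDomain_of_isRegularLocalRing _, isIntegrallyClosed_of_isRegularLocalRing _⟩

/-- **The torsor germ with isolated singularity over a two-dimensional regular local ring is a domain**
(reduced, local, Noetherian and integrally closed in its total ring of fractions). [cite: StacksProject, Tag 031S]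
[folklore] -/
theorem isDomain_of_isolated [IsRegularLocalRing S] (hdim : ringKrullDim S = (2 : ℕ))
    (hisol : ∀ (P : Ideal (AdjoinRoot ((X : S[X]) ^ p - C f))) [P.IsPrime],
      (∃ Q : Ideal (AdjoinRoot ((X : S[X]) ^ p - C f)), Q.IsPrime ∧ P < Q) →
      IsRegularLocalRing (Localization.AtPrime P)) :
    IsDomain (AdjoinRoot ((X : S[X]) ^ p - C f)) := by
  set F : S[X] := (X : S[X]) ^ p - C f with hF
  haveI hloc' : IsLocalRing (AdjoinRoot F) := isLocalRing_adjoinRoot_X_pow_sub_C_of_charP p f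
  haveI : IsNoetherianRing (AdjoinRoot F) :=
    inferInstanceAs (IsNoetherianRing (S[X] ⧸ Ideal.span {F}))
  haveI := isDomain_of_isRegularLocalRing S
  have hS : maximalIdeal S ≠ ⊥ := by
    intro h
    have h0 := ringKrullDim_eq_zero_of_isField ((isField_iff_maximalIdeal_eq).mpr h)
    rw [hdim] at h0
    have h2 : (2 : ℕ) = 0 := by exact_mod_cast h0
    exact absurd h2 two_ne_zero
  haveI := isReduced_of_isolated p f hS hisol
  haveI := isIntegrallyClosed_of_isolated p f hdim hisol
  exact isDomain_of_isReduced_of_isIntegrallyClosed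

end Radicand

/-! ## (3) The singularity criterion: `f − h^p ∈ 𝔪²` makes the torsor germ singular -/

section Singular

variable {S : Type u} [CommRing S] (p : ℕ) [hp : Fact p.Prime] [CharP S p]

/-- **Singularity criterion (⇒).** Over a regular local ring `S` of characteristic `p`: if `f − h^p ∈ 𝔪²` for
some `h`, then `T = S[X]/(X^p − f)` is NOT a regular local ring. Indeed `F = X^p − f = (X − h)^p − (f − h^p)`
lies in `𝔔²` for the prime `𝔔 = (𝔪, X − h) ⊂ S[X]` over the maximal ideal `𝔑` of `T` (`(X − h)^p ↦
f − h^p ∈ 𝔪T ⊆ 𝔑`), so the hypersurface germ `T_𝔑 = (S[X]/(F))_𝔑` is singular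
(`not_isRegularLocalRing_localization_quotient_of_mem_sq`, `S[X]` being a regular domain); but `T` regular would
make `T_𝔑` regular (Matsumura 19.3). [cite: Matsumura1987, Thm. 14.2, Thm. 19.3] [folklore] -/
theorem not_isRegularLocalRing_of_sub_pow_mem_sq [IsRegularLocalRing S] {f h : S}
    (hfh : f - h ^ p ∈ (maximalIdeal S) ^ 2) :
    ¬ IsRegularLocalRing (AdjoinRoot ((X : S[X]) ^ p - C f)) := by
  classical
  set F : S[X] := (X : S[X]) ^ p - C f with hF
  haveI hloc' : IsLocalRing (AdjoinRoot F) := isLocalRing_adjoinRoot_X_pow_sub_C_of_charP p f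
  haveI := isDomain_of_isRegularLocalRing S
  haveI : IsRegularRing S := isRegularRing_iff.mpr fun q _ => isRegularLocalRing_localization_atPrime S q
  haveI : IsRegularRing S[X] := inferInstance
  have hmon : F.Monic := NoEternalChainOne.monic_X_pow_sub_C' p f
  haveI : Module.Finite S (AdjoinRoot F) := hmon.finite_adjoinRoot
  haveI : Module.Free S (AdjoinRoot F) := hmon.free_adjoinRoot
  have hmaple := NoEternalChainOne.map_maximalIdeal_le p f
  intro hreg
  have h1 : IsRegularLocalRing (Localization.AtPrime (maximalIdeal (AdjoinRoot F))) :=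
    isRegularLocalRing_localization_atPrime (AdjoinRoot F) _
  -- the prime `𝔔 = (𝔪, X − h)` of `S[X]` over `𝔑`
  haveI hNprime : (maximalIdeal (AdjoinRoot F)).IsPrime := inferInstance
  set Q : Ideal S[X] := (maximalIdeal (AdjoinRoot F)).comap (AdjoinRoot.mk F) with hQ_def
  have hmapQ : (maximalIdeal S).map (C : S →+* S[X]) ≤ Q := by
    rw [Ideal.map_le_iff_le_comap]
    intro a ha
    rw [Ideal.mem_comap, hQ_def, Ideal.mem_comap]
    show AdjoinRoot.of F a ∈ maximalIdeal (AdjoinRoot F)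
    rw [← AdjoinRoot.algebraMap_eq]
    exact hmaple (Ideal.mem_map_of_mem _ ha)
  have hfm : f - h ^ p ∈ maximalIdeal S := Ideal.pow_le_self two_ne_zero hfh
  have hXh : X - C h ∈ Q := by
    rw [hQ_def, Ideal.mem_comap]
    have hpow : (AdjoinRoot.mk F (X - C h)) ^ p ∈ maximalIdeal (AdjoinRoot F) := by
      have hFS : FaithfulSMul S (AdjoinRoot F) := inferInstance
      haveI : CharP (AdjoinRoot F) p := charP_of_injective_algebraMap' S p
      have h1 : AdjoinRoot.mk F (X - C h) = AdjoinRoot.root F - AdjoinRoot.of F h := by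
        rw [map_sub, AdjoinRoot.mk_X, AdjoinRoot.mk_C]
      rw [h1, sub_pow_char, NoEternalChainOne.root_pow_eq, ← map_pow, ← map_sub,
        ← AdjoinRoot.algebraMap_eq]
      exact hmaple (Ideal.mem_map_of_mem _ hfm)
    exact Ideal.IsPrime.mem_of_pow_mem inferInstance p hpow
  have hF2 : F ∈ Q ^ 2 := by
    have hFeq : F = (X - C h) ^ p - C (f - h ^ p) := by
      rw [hF, sub_pow_char, ← C_pow, map_sub]; ring
    rw [hFeq]
    refine Ideal.sub_mem _ ?_ ?_
    · exact Ideal.pow_le_pow_right hp.out.two_le (Ideal.pow_mem_pow hXh p)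
    · have hC : C (f - h ^ p) ∈ ((maximalIdeal S) ^ 2).map (C : S →+* S[X]) :=
        Ideal.mem_map_of_mem _ hfh
      rw [Ideal.map_pow] at hC
      exact Ideal.pow_right_mono hmapQ 2 hC
  exact @not_isRegularLocalRing_localization_quotient_of_mem_sq S[X] _ _ _ F hmon.ne_zero
    (maximalIdeal (AdjoinRoot F)) hNprime hF2 h1

end Singular

/-! ## (4) K(2) from Lipman's theorem, given a realisation of the torsor germs as a branch of quadratic
transforms -/

section Assembly

/-- **K(2) given a realisation.** Let `S m ⊆ L` (`char L = p`) be regular local rings of dimension two carrying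
radicands `f m` of cleaned multiplicity `p` (`f m − h^p ∈ 𝔪^p`) whose torsor germs `T m = (S m)[X]/(X^p − f m)`
have isolated singularity. If the `T m` are realised (`T m ≃+* R m`) as a sequence `R : ℕ → Subring K′` of
subrings of a field with `R 0` a Noetherian excellent local ring of `K′`, every `R (m+1)` a quadratic transform
of `R m` and every `R m` of dimension two, then — `T m`, hence `R m`, being integrally closed
(`isIntegrallyClosed_of_isolated`) — Lipman's theorem `Lipman1978NoEternalNormalBranch` yields a REGULAR
`R m`, contradicting `not_isRegularLocalRing_of_sub_pow_mem_sq` (`𝔪^p ⊆ 𝔪²`). Conditional on the named fact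
(hypothesis `hL`). [cite: Lipman1978, Thm. p. 151] [cite: Artin1986, Thm. (1.1)] [folklore] -/
theorem false_of_realisation (hL : Lipman1978NoEternalNormalBranch.{0}) {p : ℕ} [Fact p.Prime]
    {L : Type} [Field L] [CharP L p] (S : ℕ → Subring L) (f : ∀ m, S m)
    (hreg : ∀ m, IsRegularLocalRing (S m)) (hdim : ∀ m, ringKrullDim (S m) = (2 : ℕ))
    (hmult : ∀ m, ∃ h : S m, f m - h ^ p ∈ maximalIdeal (S m) ^ p)
    (hisol : ∀ m, ∀ (P : Ideal (AdjoinRoot ((X : (S m)[X]) ^ p - C (f m)))) [P.IsPrime],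
      (∃ Q : Ideal (AdjoinRoot ((X : (S m)[X]) ^ p - C (f m))), Q.IsPrime ∧ P < Q) →
      IsRegularLocalRing (Localization.AtPrime P))
    {K' : Type} [Field K'] (R : ℕ → Subring K')
    (e : ∀ m, AdjoinRoot ((X : (S m)[X]) ^ p - C (f m)) ≃+* R m)
    (hR0 : IsLocalRingOf (R 0)) (hN0 : IsNoetherianRing (R 0)) (hE0 : IsExcellentRing (R 0))
    (hQT : ∀ m, IsQuadraticTransform (R m) (R (m + 1))) (hdimR : ∀ m, ringKrullDim (R m) = (2 : ℕ)) :
    False := by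
  have hnorm : ∀ m, IsIntegrallyClosed (R m) := fun m =>
    haveI := hreg m
    haveI : IsIntegrallyClosed (AdjoinRoot ((X : (S m)[X]) ^ p - C (f m))) :=
      isIntegrallyClosed_of_isolated p (f m) (hdim m) (hisol m)
    IsIntegrallyClosed.of_equiv (e m)
  obtain ⟨m, hm⟩ := hL K' R hR0 hN0 hE0 hQT hnorm (fun m => by rw [hdimR m, Nat.cast_ofNat])
  haveI := hreg m
  have hT : IsRegularLocalRing (AdjoinRoot ((X : (S m)[X]) ^ p - C (f m))) :=
    haveI := hm
    IsRegularLocalRing.of_ringEquiv (e m).symm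
  obtain ⟨h, hh⟩ := hmult m
  exact not_isRegularLocalRing_of_sub_pow_mem_sq p
    (Ideal.pow_le_pow_right (Fact.out : p.Prime).two_le hh) hT

end Assembly

end RadicandChainTwo

end Summit.ResolutionOfSingularities.ResolutionOfSingularities.Theorems.SwitchingDichotomy

end
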